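import Literature.MathematicalPhysics.QuantumLattice.LatticeGaugeDLRGibbsProofs
import HarnessLib

/-!
# Venture YMGap, track ROBUST-BALL — the CHERNOFF BOUND FOR THE ENERGY OF A FINITE REGION WITH A BOUNDARY FIELD, and its transfer to
# every DLR state (door of «C-LD-E» with boundary conditions)

HONEST FRAMING. WHAT THIS IS: a venture file (cell `pub-ymgap`, track Y2 ROBUST-BALL / DS, seat ds-3, theorems only, 0 compute). Generic: every
compact metrisable gauge group `G`, continuous `ρ`, every dimension `d`, every finite link volume `Λ ⊂ links(ℤ^d)`, boundary field `η`, real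
coupling `b`, tilt `t`, level `a`; `S_Λ` = the boundary Wilson action (tree `wilsonBoundaryAction`), `γ_Λ^b(·|η)` the Wilson DLR kernel (tree
`ymSpecification`), `Z_Λ(b|η) = ∫ exp(−b S_Λ(ζ ⊕ η_{Λᶜ})) ∏_{e∈Λ} dζ_e` its normaliser:
* `kernel_integral_exp_tilt_eq` — `∫ exp(t(a − S_Λ)) dγ_Λ^b(·|η) = exp(t a + log Z_Λ(b+t|η) − log Z_Λ(b|η))`;
* ★ `kernel_measureReal_tilt_le` — `γ_Λ^b({t·S_Λ ≤ t·a} | η) ≤ exp(t a + log Z_Λ(b+t|η) − log Z_Λ(b|η))` (exponential Markov inequality; lower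
  tail of the energy for `t > 0`, upper tail for `t < 0`);
* ★ `gibbs_measureReal_le_of_forall_kernel` — a bound on `γ_Λ(A|η)` UNIFORM in the boundary field `η` is a bound on `μ(A)` for EVERY DLR state `μ`
  (the DLR equation `μ(A) = ∫ γ_Λ(A|η) dμ(η)`): this is how boundary-uniform estimates («C-DS-I») become statements about all Gibbs states.
The `SU(2)` cell — a Cramér–Chernoff large-deviation upper bound for the energy of a finite region, uniform in the boundary field and valid for
every DLR state, with the infinite-volume free energy as rate generator and the «C-DS-I» surface remainder — is the sequel
`KernelEnergyLargeDeviations.lean`.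
WHAT THIS IS NOT: upper bounds only; lattice; nothing about the continuum limit or Clay. Everything here is proved. [folklore]
-/

noncomputable section

open MeasureTheory ProbabilityTheory Real Set
open Literature.Probability.LatticeModels hiding configShift configShift_apply
open Literature.MathematicalPhysics.QuantumLattice
open Literature.MathematicalPhysics.QuantumFieldTheory (haarProbability)

namespace Summit.Ventures.YMGap.RobustBall

namespace BoundaryFreeEnergy

section Generic

variable {d N : ℕ} {G : Type*} [Group G] [TopologicalSpace G] [IsTopologicalGroup G] [CompactSpace G]
  [MeasurableSpace G] [BorelSpace G] [SecondCountableTopology G] (ρ : G →* Matrix (Fin N) (Fin N) ℂ)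

/-- **The tilted Boltzmann factor under the kernel is a ratio of normalisers**:
`∫ exp(t(a − S_Λ)) dγ_Λ^b(·|η) = exp(t a + log Z_Λ(b+t|η) − log Z_Λ(b|η))`. [folklore] -/
theorem kernel_integral_exp_tilt_eq (hρ : Continuous ρ) (b t a : ℝ) (Λ : Finset (ZdEdge d)) (η : LGConfig d G) :
    ∫ U, Real.exp (t * (a - wilsonBoundaryAction ρ Λ U)) ∂(ymSpecification ρ b Λ η) =
      Real.exp (t * a +
        Real.log (∫ ζ, Real.exp (-(b + t) * wilsonBoundaryAction ρ Λ (glueWith Λ ζ η)) ∂(Measure.pi fun _ : ↥Λ => haarProbability G)) -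
        Real.log (∫ ζ, Real.exp (-b * wilsonBoundaryAction ρ Λ (glueWith Λ ζ η)) ∂(Measure.pi fun _ : ↥Λ => haarProbability G))) := by
  have hS : Continuous (wilsonBoundaryAction (G := G) ρ Λ) := continuous_wilsonBoundaryAction ρ hρ Λ
  have hF : Measurable fun U : LGConfig d G => Real.exp (t * (a - wilsonBoundaryAction ρ Λ U)) :=
    Real.measurable_exp.comp ((measurable_const.sub hS.measurable).const_mul t)
  rw [integral_ymSpecification ρ hρ b Λ hF η, Real.exp_sub, Real.exp_add, Real.exp_log (normaliser_pos ρ hρ _ Λ η),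
    Real.exp_log (normaliser_pos ρ hρ _ Λ η), ← integral_const_mul]
  congr 1
  refine integral_congr_ae (ae_of_all _ fun ζ => ?_)
  dsimp only
  rw [← Real.exp_add, ← Real.exp_add]
  congr 1; ring

/-- ★ **THE CHERNOFF BOUND FOR THE ENERGY OF A FINITE REGION WITH A BOUNDARY FIELD.** For every compact metrisable `G`, continuous `ρ`, finite `Λ`,
boundary field `η`, coupling `b`, tilt `t`, level `a`:
`γ_Λ^b({U : t·S_Λ(U) ≤ t·a} | η) ≤ exp(t a + log Z_Λ(b+t|η) − log Z_Λ(b|η))`. [folklore] -/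
theorem kernel_measureReal_tilt_le (hρ : Continuous ρ) (b t a : ℝ) (Λ : Finset (ZdEdge d)) (η : LGConfig d G) :
    (ymSpecification ρ b Λ η).real {U | t * wilsonBoundaryAction ρ Λ U ≤ t * a} ≤
      Real.exp (t * a +
        Real.log (∫ ζ, Real.exp (-(b + t) * wilsonBoundaryAction ρ Λ (glueWith Λ ζ η)) ∂(Measure.pi fun _ : ↥Λ => haarProbability G)) -
        Real.log (∫ ζ, Real.exp (-b * wilsonBoundaryAction ρ Λ (glueWith Λ ζ η)) ∂(Measure.pi fun _ : ↥Λ => haarProbability G))) := by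
  haveI := isProbabilityMeasure_ymSpecification ρ hρ b Λ η
  set μ := ymSpecification ρ b Λ η with hμ
  set A : Set (LGConfig d G) := {U | t * wilsonBoundaryAction ρ Λ U ≤ t * a} with hA
  have hS : Continuous (wilsonBoundaryAction (G := G) ρ Λ) := continuous_wilsonBoundaryAction ρ hρ Λ
  have hAm : MeasurableSet A := measurableSet_le (hS.measurable.const_mul t) measurable_const
  obtain ⟨C, hC⟩ := exists_bound_of_continuous hS
  have hint : Integrable (fun U : LGConfig d G => Real.exp (t * (a - wilsonBoundaryAction ρ Λ U))) μ := by
    refine integrable_of_bound (Real.measurable_exp.comp ((measurable_const.sub hS.measurable).const_mul t)).aestronglyMeasurable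
      (C := Real.exp (|t| * (|a| + C))) fun U => ?_
    rw [Real.abs_exp]
    refine Real.exp_le_exp.2 ((le_abs_self _).trans ?_)
    rw [abs_mul]
    refine mul_le_mul_of_nonneg_left ((abs_sub _ _).trans (add_le_add le_rfl (hC U))) (abs_nonneg t)
  have hind : ∫ U, A.indicator (fun _ => (1 : ℝ)) U ∂μ = μ.real A := by
    rw [integral_indicator_const _ hAm, smul_eq_mul, mul_one]
  rw [← hind, ← kernel_integral_exp_tilt_eq ρ hρ b t a Λ η]
  refine integral_mono ((integrable_const _).indicator hAm) hint fun U => ?_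
  by_cases hU : U ∈ A
  · rw [Set.indicator_of_mem hU]
    have hU' : t * wilsonBoundaryAction ρ Λ U ≤ t * a := hU
    exact Real.one_le_exp (by nlinarith)
  · rw [Set.indicator_of_notMem hU]
    exact (Real.exp_pos _).le

end Generic

/-! ### From boundary-uniform kernel bounds to every DLR state -/

section DLR

variable {V S : Type*} [MeasurableSpace S]

/-- ★ **A bound on the kernel probability UNIFORM IN THE BOUNDARY FIELD bounds the probability under EVERY Gibbs measure** (the DLR
equation `μ(A) = ∫ γ_Λ(A|η) dμ(η)`): if `γ_Λ(A|η) ≤ c` for all `η` (kernels being probability measures), then `μ(A) ≤ c` for every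
`μ ∈ 𝒢(γ)`. [folklore] -/
theorem gibbs_measureReal_le_of_forall_kernel {γ : Specification V S} {μ : Measure (V → S)} (hμ : IsGibbsMeasure γ μ)
    (Λ : Finset V) {A : Set (V → S)} (hA : MeasurableSet A) {c : ℝ} (hc : 0 ≤ c)
    (hker : ∀ η, (γ Λ η).real A ≤ c) (hfin : ∀ η, IsFiniteMeasure (γ Λ η)) : μ.real A ≤ c := by
  haveI := hμ.1
  have hDLR := hμ.2 Λ A hA
  have hle : ∫⁻ η, γ Λ η A ∂μ ≤ ∫⁻ _η, ENNReal.ofReal c ∂μ := by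
    refine lintegral_mono fun η => ?_
    haveI := hfin η
    rw [← ENNReal.ofReal_toReal (measure_ne_top (γ Λ η) A)]
    exact ENNReal.ofReal_le_ofReal (hker η)
  rw [lintegral_const, measure_univ, mul_one, hDLR] at hle
  rw [Measure.real, ← ENNReal.toReal_ofReal hc]
  exact ENNReal.toReal_mono ENNReal.ofReal_ne_top hle

end DLR

end BoundaryFreeEnergy

end Summit.Ventures.YMGap.RobustBall

end
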